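import Summits.Ventures.QEC.Thresholds.PlanarSurfaceCodeThresholds
import Summits.Ventures.QEC.Thresholds.CSSPhenomenologicalThresholds
import Literature.InformationTheory.QuantumCodes.HypergraphProductThresholds
import Literature.InformationTheory.QuantumCodes.SyndromeDecodingCSS
import HarnessLib

/-!
# Certified thresholds for families of CSS codes given as `CSSCode` OBJECTS (the census form):
# both sectors, code capacity `p₀(w-1)`, erasure `1/(w-1)`, phenomenological `p₀(w+1)`

Venture QEC, `Summits/Ventures/QEC/Thresholds/` (LADDER-QEC rung Q5, cell Q5.hgp; qec-type-09 gen 3, item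
09.HGPTH of PARTITION v2.12). The census rows of this cell are OBJECTS of row type-02's structure
`Literature.InformationTheory.QuantumCodes.CSSCode RX RZ Q` over arbitrary finite index types (the hypergraph
product `Summit.Ventures.QEC.HGP.code H₁ H₂` lives on `(Fin n₁ × Fin n₂) ⊕ (Fin m₁ × Fin m₂)`, the
bivariate-bicycle codes on monomials, the toric code on torus sites). This file states the Dumer–Kovalev–Pryadko
threshold theorems of the tree (qec-lit-2's type-family forms `codeCapacityThreshold_of_rowWeight'`,
`erasureThreshold_of_rowWeight'`, `phenomThreshold_of_rowWeight'` of `HypergraphProductThresholds.lean`) for a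
FAMILY `C i : CSSCode (RX i) (RZ i) (Q i)` of such objects, in BOTH sectors, in the cell's vocabulary
`IsThresholdLowerBound` / `thresholdValue` / `accuracyThreshold`:

* `Z`-sector (phase flips `Z(e)`: syndrome `H^X e = C.zSyndrome e`, undetectable set `ker H^X = C.kerX`, trivial
  set `rs H^Z = C.rowSpZ`, distance `d^Z`): `zFailureFamily` (independent errors, a decoder family `D`),
  `zErasureFamily` (independent erasures), `zPhenomFailureFamily` (`T i` noisy rounds, `q = p`, space-time decoders);
* `X`-sector (bit flips: `H^Z`, `ker H^Z`, `rs H^X`, `d^X`): `xFailureFamily`, `xErasureFamily`, `xPhenomFailureFamily`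
  — DEFINITIONALLY the `Z`-families of the exchanged codes `(C i).swap` (`xFailureFamily_eq_swap`, …), so every
  `X`-theorem is the `Z`-theorem of the swap;
* theorems `z_isThresholdLowerBound_of_rowWeight` / `x_…` (checks of the sector of weight `≤ w`, `w ≥ 2`, every
  non-trivial undetectable error of weight `≥ d i ≥ 1`, `|Q i| r^{d i} → 0` for all `0 < r < 1`, ANY minimum-weight
  decoders ⇒ threshold `≥ p₀(w-1) = thresholdValue (w-1)`), `z_erasure_isThresholdLowerBound_of_rowWeight` / `x_…`
  (`≥ 1/(w-1)`), `z_phenom_isThresholdLowerBound_of_rowWeight` / `x_…` (`(|Q i| + #checks)·T i·r^{d i} → 0` ⇒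
  `≥ p₀(w+1)`), and the `d ≤ d^Z` / `d ≤ d^X` forms of the distance hypothesis (`le_weight_of_le_dZ`, `le_weight_of_le_dX`).

HONEST FRAMING: UNCONDITIONAL theorems about every family satisfying the printed hypotheses; kernel axioms, no
named fact, no `native_decide`. The growth hypothesis (distance `→ ∞` faster than `log` of the size) is a
hypothesis — it is discharged for explicit families in `HypergraphProductFamilyThresholds.lean` (finite-size form
for census rows) and `ToricCodeHGPThresholds.lean` (toric codes as hypergraph products). A sector with no logical
operator (`ker = rs`) satisfies every distance hypothesis vacuously; non-vacuity is recorded per family there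
(`k > 0`). Nothing here is a statement about a numerical (Monte Carlo) threshold.

## References

* [DumerKovalevPryadko2015] I. Dumer, A. A. Kovalev, L. P. Pryadko, PRL 115 (2015) 050502, Thm 2 (code capacity
  `y = 0`, erasures), Thm 3 and p. 5 (`w → w + 2`, phenomenological).
* [DennisEtAl2002] E. Dennis, A. Kitaev, A. Landahl, J. Preskill, J. Math. Phys. 43 (2002) 4452, §4.3 (below
  threshold), §5.2–5.3 (Prob_fail, `p = q`).
* [BravyiEtAl2024] S. Bravyi et al., Nature 627 (2024) 778, §4 Lemma 1 (`d^X`, `d^Z` of a CSS pair).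
-/

noncomputable section

namespace Summit.Ventures.QEC.Thresholds

open Filter Topology Finset Matrix
open Literature.InformationTheory.QuantumCodes

variable {RX RZ Q : ℕ → Type*}

/-! ### The six failure families of a family of CSS codes -/

open Classical in
/-- **`Z`-sector code-capacity failure family**: for the `i`-th code, the probability (independent phase flips
of rate `p`, weight `p^{|e|}(1-p)^{n-|e|}`) that the decoder `D i` of the `X`-syndrome `H^X e` leaves a residual
`D(H^X e) + e ∉ rs H^Z` (a `Z`-logical error). [cite: DumerKovalevPryadko2015, Thm 2 (y = 0; one error type of a CSS code)] -/
def zFailureFamily [∀ i, Fintype (Q i)] [∀ i, DecidableEq (Q i)] [∀ i, Fintype (RZ i)]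
    (C : ∀ i, CSSCode (RX i) (RZ i) (Q i))
    (D : ∀ i, Decoder (RX i → ZMod 2) (Q i → ZMod 2)) : ℕ → ℝ → ℝ :=
  fun i p => ∑ e ∈ univ.filter (fun e : Q i → ZMod 2 =>
      ¬ (D i).Corrects (C i).zSyndrome ((C i).rowSpZ : Set (Q i → ZMod 2)) e),
    bernoulliWeight p (supp e)

open Classical in
/-- **`X`-sector code-capacity failure family**: independent bit flips of rate `p`, decoder `D i` of the
`Z`-syndrome `H^Z e`, failure iff `D(H^Z e) + e ∉ rs H^X`. [cite: DumerKovalevPryadko2015, Thm 2 (y = 0; the other error type)] -/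
def xFailureFamily [∀ i, Fintype (Q i)] [∀ i, DecidableEq (Q i)] [∀ i, Fintype (RX i)]
    (C : ∀ i, CSSCode (RX i) (RZ i) (Q i))
    (D : ∀ i, Decoder (RZ i → ZMod 2) (Q i → ZMod 2)) : ℕ → ℝ → ℝ :=
  fun i p => ∑ e ∈ univ.filter (fun e : Q i → ZMod 2 =>
      ¬ (D i).Corrects (C i).xSyndrome ((C i).rowSpX : Set (Q i → ZMod 2)) e),
    bernoulliWeight p (supp e)

/-- The `X`-sector family IS the `Z`-sector family of the `X ↔ Z` exchanged codes (definitional).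
[cite: DumerKovalevPryadko2015, Thm 2 (the two error types of a CSS code enter symmetrically)] -/
theorem xFailureFamily_eq_swap [∀ i, Fintype (Q i)] [∀ i, DecidableEq (Q i)] [∀ i, Fintype (RX i)]
    (C : ∀ i, CSSCode (RX i) (RZ i) (Q i))
    (D : ∀ i, Decoder (RZ i → ZMod 2) (Q i → ZMod 2)) :
    xFailureFamily C D = zFailureFamily (fun i => (C i).swap) D := rfl

/-- **`Z`-sector erasure family**: the probability that an independent erasure pattern of rate `y` is
uncorrectable for the `Z`-sector (some undetectable `Z`-error inside the erased set is not in `rs H^Z`).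
[cite: DumerKovalevPryadko2015, Thm 2 (erasure part)] -/
def zErasureFamily [∀ i, Fintype (Q i)] [∀ i, Fintype (RZ i)]
    (C : ∀ i, CSSCode (RX i) (RZ i) (Q i)) : ℕ → ℝ → ℝ :=
  fun i y => ErasureDecoder.uncorrectableProb {x : Q i → ZMod 2 | (C i).HX *ᵥ x = 0}
    ((C i).rowSpZ : Set (Q i → ZMod 2)) y

/-- **`X`-sector erasure family** (uncorrectable erasures for bit flips: `ker H^Z`, `rs H^X`).
[cite: DumerKovalevPryadko2015, Thm 2 (erasure part)] -/
def xErasureFamily [∀ i, Fintype (Q i)] [∀ i, Fintype (RX i)]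
    (C : ∀ i, CSSCode (RX i) (RZ i) (Q i)) : ℕ → ℝ → ℝ :=
  fun i y => ErasureDecoder.uncorrectableProb {x : Q i → ZMod 2 | (C i).HZ *ᵥ x = 0}
    ((C i).rowSpX : Set (Q i → ZMod 2)) y

/-- The `X`-sector erasure family is the `Z`-sector erasure family of the exchanged codes (definitional).
[cite: DumerKovalevPryadko2015, Thm 2 (erasure part; symmetric in the two error types)] -/
theorem xErasureFamily_eq_swap [∀ i, Fintype (Q i)] [∀ i, Fintype (RX i)]
    (C : ∀ i, CSSCode (RX i) (RZ i) (Q i)) :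
    xErasureFamily C = zErasureFamily (fun i => (C i).swap) := rfl

/-- **`Z`-sector phenomenological failure family** (`q = p`): the `T i`-round memory experiment of the `i`-th
code with noisy `X`-syndrome measurement (qubit phase flips at rate `p` per round, wrong syndrome bits at rate
`p`, perfect closing round), space-time decoder `D i`; failure iff the projected residual is not in `rs H^Z`.
[cite: DennisEtAl2002, §5.2 (Prob_fail) and §5.3 (p = q)] -/
def zPhenomFailureFamily
    [∀ i, Fintype (Q i)] [∀ i, DecidableEq (Q i)] [∀ i, Fintype (RX i)] [∀ i, DecidableEq (RX i)]
    [∀ i, Fintype (RZ i)]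
    (C : ∀ i, CSSCode (RX i) (RZ i) (Q i)) (T : ℕ → ℕ)
    (D : ∀ i, CSSPhenom.STDecoder (RX i) (Q i) (T i)) : ℕ → ℝ → ℝ :=
  fun i p => CSSPhenom.phenomFailureProb (C i).HX (T i) ((C i).rowSpZ : Set (Q i → ZMod 2)) (D i) p p

/-- **`X`-sector phenomenological failure family** (`q = p`; noisy `Z`-syndrome measurement, bit flips).
[cite: DennisEtAl2002, §5.2 (Prob_fail) and §5.3 (p = q)] -/
def xPhenomFailureFamily
    [∀ i, Fintype (Q i)] [∀ i, DecidableEq (Q i)] [∀ i, Fintype (RZ i)] [∀ i, DecidableEq (RZ i)]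
    [∀ i, Fintype (RX i)]
    (C : ∀ i, CSSCode (RX i) (RZ i) (Q i)) (T : ℕ → ℕ)
    (D : ∀ i, CSSPhenom.STDecoder (RZ i) (Q i) (T i)) : ℕ → ℝ → ℝ :=
  fun i p => CSSPhenom.phenomFailureProb (C i).HZ (T i) ((C i).rowSpX : Set (Q i → ZMod 2)) (D i) p p

/-- The `X`-sector phenomenological family is the `Z`-sector one of the exchanged codes (definitional).
[cite: DennisEtAl2002, §5.2–5.3 (the two defect types are treated identically)] -/
theorem xPhenomFailureFamily_eq_swap
    [∀ i, Fintype (Q i)] [∀ i, DecidableEq (Q i)] [∀ i, Fintype (RZ i)] [∀ i, DecidableEq (RZ i)]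
    [∀ i, Fintype (RX i)]
    (C : ∀ i, CSSCode (RX i) (RZ i) (Q i)) (T : ℕ → ℕ)
    (D : ∀ i, CSSPhenom.STDecoder (RZ i) (Q i) (T i)) :
    xPhenomFailureFamily C T D = zPhenomFailureFamily (fun i => (C i).swap) T D := rfl

/-! ### Distance hypotheses from `d^Z`, `d^X` -/

/-- `d ≤ d^Z` puts every `Z`-logical (`H^X x = 0`, `x ∉ rs H^Z`) at weight `≥ d` — the shape of the distance
hypothesis of the threshold theorems below. [cite: BravyiEtAl2024, §4, proof of Lemma 1 (d^Z = min{|v| : v ∈ ker H^X ∖ rs H^Z})] -/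
theorem le_weight_of_le_dZ [∀ i, Fintype (Q i)] [∀ i, Fintype (RZ i)]
    (C : ∀ i, CSSCode (RX i) (RZ i) (Q i)) {d : ℕ → ℕ} (h : ∀ i, d i ≤ (C i).dZ)
    (i : ℕ) (x : Q i → ZMod 2) (hx : (C i).HX *ᵥ x = 0) (hxS : x ∉ (C i).rowSpZ) : d i ≤ hammingNorm x :=
  (h i).trans ((C i).dZ_le_hammingNorm hx hxS)

/-- `d ≤ d^X` puts every `X`-logical (`H^Z x = 0`, `x ∉ rs H^X`) at weight `≥ d`.
[cite: BravyiEtAl2024, §4, proof of Lemma 1 (d^X = min{|v| : v ∈ ker H^Z ∖ rs H^X})] -/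
theorem le_weight_of_le_dX [∀ i, Fintype (Q i)] [∀ i, Fintype (RX i)]
    (C : ∀ i, CSSCode (RX i) (RZ i) (Q i)) {d : ℕ → ℕ} (h : ∀ i, d i ≤ (C i).dX)
    (i : ℕ) (x : Q i → ZMod 2) (hx : (C i).HZ *ᵥ x = 0) (hxS : x ∉ (C i).rowSpX) : d i ≤ hammingNorm x :=
  (h i).trans ((C i).dX_le_hammingNorm hx hxS)

/-! ### Code capacity: `p₀(w-1)` in both sectors -/

/-- **`Z`-sector code-capacity threshold `≥ p₀(w-1)`** for a family of CSS codes: `X`-checks of weight `≤ w`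
(`w ≥ 2`), every `Z`-logical of the `i`-th code of weight `≥ d i ≥ 1`, `|Q i|·r^{d i} → 0` for all `0 < r < 1`,
ANY minimum-weight decoders of the `X`-syndrome; then every `0 ≤ p < p₀(w-1) = (1-√(1-(w-1)⁻²))/2` is below
threshold. UNCONDITIONAL. [cite: DumerKovalevPryadko2015, Thm 2 (y = 0)] -/
theorem z_isThresholdLowerBound_of_rowWeight
    [∀ i, Fintype (Q i)] [∀ i, DecidableEq (Q i)] [∀ i, Fintype (RZ i)]
    (C : ∀ i, CSSCode (RX i) (RZ i) (Q i))
    (D : ∀ i, Decoder (RX i → ZMod 2) (Q i → ZMod 2))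
    (hD : ∀ i, (D i).IsMinWeight (C i).zSyndrome ((C i).kerX : Set (Q i → ZMod 2)) hammingNorm)
    {w : ℕ} (hw : 2 ≤ w) (hrow : ∀ i x, (rowSupp (C i).HX x).card ≤ w) (d : ℕ → ℕ) (hd1 : ∀ i, 1 ≤ d i)
    (hd : ∀ i (x : Q i → ZMod 2), (C i).HX *ᵥ x = 0 → x ∉ (C i).rowSpZ → d i ≤ hammingNorm x)
    (hgrowth : ∀ r : ℝ, 0 < r → r < 1 →
      Tendsto (fun i => (Fintype.card (Q i) : ℝ) * r ^ d i) atTop (𝓝 0)) :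
    IsThresholdLowerBound (zFailureFamily C D) (thresholdValue ((w - 1 : ℕ) : ℝ)) := by
  intro p hp₀ hpp
  have hK1 : (1 : ℝ) ≤ ((w - 1 : ℕ) : ℝ) := by exact_mod_cast (show 1 ≤ w - 1 by omega)
  have hp : p ≤ 1 / 2 := le_trans hpp.le (thresholdValue_le_half _)
  have h4 := four_mul_sq_mul_lt_one_of_lt_thresholdValue hK1 hpp
  have hD' : ∀ i, (D i).IsMinWeight (fun e => (C i).HX *ᵥ e) {x | (C i).HX *ᵥ x = 0} hammingNorm := hD
  exact codeCapacityThreshold_of_rowWeight' (fun i => (C i).HX) (fun i => (C i).rowSpZ) D hD' hw hrow d hd1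
    hd hgrowth hp₀ hp h4

/-- **`X`-sector code-capacity threshold `≥ p₀(w-1)`**: `Z`-checks of weight `≤ w`, every `X`-logical of weight
`≥ d i ≥ 1`, `|Q i|·r^{d i} → 0`, ANY minimum-weight decoders of the `Z`-syndrome. UNCONDITIONAL (the
`Z`-theorem of the exchanged codes). [cite: DumerKovalevPryadko2015, Thm 2 (y = 0)] -/
theorem x_isThresholdLowerBound_of_rowWeight
    [∀ i, Fintype (Q i)] [∀ i, DecidableEq (Q i)] [∀ i, Fintype (RX i)]
    (C : ∀ i, CSSCode (RX i) (RZ i) (Q i))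
    (D : ∀ i, Decoder (RZ i → ZMod 2) (Q i → ZMod 2))
    (hD : ∀ i, (D i).IsMinWeight (C i).xSyndrome ((C i).kerZ : Set (Q i → ZMod 2)) hammingNorm)
    {w : ℕ} (hw : 2 ≤ w) (hrow : ∀ i x, (rowSupp (C i).HZ x).card ≤ w) (d : ℕ → ℕ) (hd1 : ∀ i, 1 ≤ d i)
    (hd : ∀ i (x : Q i → ZMod 2), (C i).HZ *ᵥ x = 0 → x ∉ (C i).rowSpX → d i ≤ hammingNorm x)
    (hgrowth : ∀ r : ℝ, 0 < r → r < 1 →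
      Tendsto (fun i => (Fintype.card (Q i) : ℝ) * r ^ d i) atTop (𝓝 0)) :
    IsThresholdLowerBound (xFailureFamily C D) (thresholdValue ((w - 1 : ℕ) : ℝ)) :=
  z_isThresholdLowerBound_of_rowWeight (fun i => (C i).swap) D hD hw hrow d hd1 hd hgrowth

/-- Decimal / `accuracyThreshold` form, `Z`-sector: `p₀(w-1) ≤ p_c(zFailureFamily C D)`.
[cite: DennisEtAl2002, §5.3 (a lower bound on the accuracy threshold)] -/
theorem z_thresholdValue_le_accuracyThreshold
    [∀ i, Fintype (Q i)] [∀ i, DecidableEq (Q i)] [∀ i, Fintype (RZ i)]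
    (C : ∀ i, CSSCode (RX i) (RZ i) (Q i))
    (D : ∀ i, Decoder (RX i → ZMod 2) (Q i → ZMod 2))
    (hD : ∀ i, (D i).IsMinWeight (C i).zSyndrome ((C i).kerX : Set (Q i → ZMod 2)) hammingNorm)
    {w : ℕ} (hw : 2 ≤ w) (hrow : ∀ i x, (rowSupp (C i).HX x).card ≤ w) (d : ℕ → ℕ) (hd1 : ∀ i, 1 ≤ d i)
    (hd : ∀ i (x : Q i → ZMod 2), (C i).HX *ᵥ x = 0 → x ∉ (C i).rowSpZ → d i ≤ hammingNorm x)
    (hgrowth : ∀ r : ℝ, 0 < r → r < 1 →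
      Tendsto (fun i => (Fintype.card (Q i) : ℝ) * r ^ d i) atTop (𝓝 0)) :
    thresholdValue ((w - 1 : ℕ) : ℝ) ≤ accuracyThreshold (zFailureFamily C D) :=
  le_accuracyThreshold (z_isThresholdLowerBound_of_rowWeight C D hD hw hrow d hd1 hd hgrowth)
    ((thresholdValue_le_half _).trans (by norm_num))

/-! ### Erasures: `1/(w-1)` in both sectors -/

/-- **`Z`-sector erasure threshold `≥ 1/(w-1)`**: `X`-checks of weight `≤ w` (`w ≥ 2`), `Z`-logicals of weight
`≥ d i ≥ 1`, `|Q i|·r^{d i} → 0`; then for every loss rate `0 ≤ y < 1/(w-1)` the probability that the erasure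
pattern is uncorrectable `→ 0`. UNCONDITIONAL. [cite: DumerKovalevPryadko2015, Thm 2 (erasure part)] -/
theorem z_erasure_isThresholdLowerBound_of_rowWeight
    [∀ i, Fintype (Q i)] [∀ i, DecidableEq (Q i)] [∀ i, Fintype (RZ i)]
    (C : ∀ i, CSSCode (RX i) (RZ i) (Q i))
    {w : ℕ} (hw : 2 ≤ w) (hrow : ∀ i x, (rowSupp (C i).HX x).card ≤ w) (d : ℕ → ℕ) (hd1 : ∀ i, 1 ≤ d i)
    (hd : ∀ i (x : Q i → ZMod 2), (C i).HX *ᵥ x = 0 → x ∉ (C i).rowSpZ → d i ≤ hammingNorm x)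
    (hgrowth : ∀ r : ℝ, 0 < r → r < 1 →
      Tendsto (fun i => (Fintype.card (Q i) : ℝ) * r ^ d i) atTop (𝓝 0)) :
    IsThresholdLowerBound (zErasureFamily C) (1 / ((w - 1 : ℕ) : ℝ)) := by
  intro y hy₀ hy
  have hK0 : (0 : ℝ) < ((w - 1 : ℕ) : ℝ) := by exact_mod_cast (show 0 < w - 1 by omega)
  have hy' : ((w - 1 : ℕ) : ℝ) * y < 1 := by
    have := (lt_div_iff₀ hK0).1 hy
    linarith [mul_comm y (((w - 1 : ℕ) : ℝ))]
  exact erasureThreshold_of_rowWeight' (fun i => (C i).HX) (fun i => (C i).rowSpZ) hw hrow d hd1 hd hgrowth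
    hy₀ hy'

/-- **`X`-sector erasure threshold `≥ 1/(w-1)`** (`Z`-checks of weight `≤ w`, `X`-logicals of weight `≥ d i`).
UNCONDITIONAL. [cite: DumerKovalevPryadko2015, Thm 2 (erasure part)] -/
theorem x_erasure_isThresholdLowerBound_of_rowWeight
    [∀ i, Fintype (Q i)] [∀ i, DecidableEq (Q i)] [∀ i, Fintype (RX i)]
    (C : ∀ i, CSSCode (RX i) (RZ i) (Q i))
    {w : ℕ} (hw : 2 ≤ w) (hrow : ∀ i x, (rowSupp (C i).HZ x).card ≤ w) (d : ℕ → ℕ) (hd1 : ∀ i, 1 ≤ d i)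
    (hd : ∀ i (x : Q i → ZMod 2), (C i).HZ *ᵥ x = 0 → x ∉ (C i).rowSpX → d i ≤ hammingNorm x)
    (hgrowth : ∀ r : ℝ, 0 < r → r < 1 →
      Tendsto (fun i => (Fintype.card (Q i) : ℝ) * r ^ d i) atTop (𝓝 0)) :
    IsThresholdLowerBound (xErasureFamily C) (1 / ((w - 1 : ℕ) : ℝ)) :=
  z_erasure_isThresholdLowerBound_of_rowWeight (fun i => (C i).swap) hw hrow d hd1 hd hgrowth

/-! ### Phenomenological noise (`q = p`): `p₀(w+1)` in both sectors -/

/-- **`Z`-sector phenomenological threshold `≥ p₀(w+1)`** (`q = p`): `X`-checks of weight `≤ w`, `Z`-logicals of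
weight `≥ d i ≥ 1`, space-time size subexponential in the distance — `(|Q i| + |RX i|)·T i·r^{d i} → 0` for all
`0 < r < 1` — and ANY minimum-weight space-time decoders; then every `0 ≤ p < p₀(w+1)` is below threshold for the
`T i`-round memory experiments. UNCONDITIONAL. [cite: DumerKovalevPryadko2015, Thm 3 with p. 5 (w → w + 2)] -/
theorem z_phenom_isThresholdLowerBound_of_rowWeight
    [∀ i, Fintype (Q i)] [∀ i, DecidableEq (Q i)] [∀ i, Fintype (RX i)] [∀ i, DecidableEq (RX i)]
    [∀ i, Fintype (RZ i)]
    (C : ∀ i, CSSCode (RX i) (RZ i) (Q i)) (T : ℕ → ℕ)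
    (D : ∀ i, CSSPhenom.STDecoder (RX i) (Q i) (T i))
    (hD : ∀ i, (D i).IsMinWeight (CSSPhenom.stSyn (C i).HX (T i)) (CSSPhenom.stCycles (C i).HX (T i))
      hammingNorm)
    {w : ℕ} (hrow : ∀ i x, (rowSupp (C i).HX x).card ≤ w) (d : ℕ → ℕ) (hd1 : ∀ i, 1 ≤ d i)
    (hd : ∀ i (x : Q i → ZMod 2), (C i).HX *ᵥ x = 0 → x ∉ (C i).rowSpZ → d i ≤ hammingNorm x)
    (hgrowth : ∀ r : ℝ, 0 < r → r < 1 →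
      Tendsto (fun i => (((Fintype.card (Q i) + Fintype.card (RX i)) * T i : ℕ) : ℝ) * r ^ d i)
        atTop (𝓝 0)) :
    IsThresholdLowerBound (zPhenomFailureFamily C T D) (thresholdValue ((w + 1 : ℕ) : ℝ)) := by
  intro p hp₀ hpp
  have hK1 : (1 : ℝ) ≤ ((w + 1 : ℕ) : ℝ) := by exact_mod_cast (show 1 ≤ w + 1 by omega)
  have hp : p ≤ 1 / 2 := le_trans hpp.le (thresholdValue_le_half _)
  have h4 := four_mul_sq_mul_lt_one_of_lt_thresholdValue hK1 hpp
  exact phenomThreshold_of_rowWeight' (fun i => (C i).HX) (fun i => (C i).rowSpZ) T D hD hrow d hd1 hd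
    hgrowth hp₀ hp h4

/-- **`X`-sector phenomenological threshold `≥ p₀(w+1)`** (`q = p`; `Z`-checks of weight `≤ w`, `X`-logicals of
weight `≥ d i`, `(|Q i| + |RZ i|)·T i·r^{d i} → 0`, ANY minimum-weight space-time decoders). UNCONDITIONAL.
[cite: DumerKovalevPryadko2015, Thm 3 with p. 5 (w → w + 2)] -/
theorem x_phenom_isThresholdLowerBound_of_rowWeight
    [∀ i, Fintype (Q i)] [∀ i, DecidableEq (Q i)] [∀ i, Fintype (RZ i)] [∀ i, DecidableEq (RZ i)]
    [∀ i, Fintype (RX i)]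
    (C : ∀ i, CSSCode (RX i) (RZ i) (Q i)) (T : ℕ → ℕ)
    (D : ∀ i, CSSPhenom.STDecoder (RZ i) (Q i) (T i))
    (hD : ∀ i, (D i).IsMinWeight (CSSPhenom.stSyn (C i).HZ (T i)) (CSSPhenom.stCycles (C i).HZ (T i))
      hammingNorm)
    {w : ℕ} (hrow : ∀ i x, (rowSupp (C i).HZ x).card ≤ w) (d : ℕ → ℕ) (hd1 : ∀ i, 1 ≤ d i)
    (hd : ∀ i (x : Q i → ZMod 2), (C i).HZ *ᵥ x = 0 → x ∉ (C i).rowSpX → d i ≤ hammingNorm x)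
    (hgrowth : ∀ r : ℝ, 0 < r → r < 1 →
      Tendsto (fun i => (((Fintype.card (Q i) + Fintype.card (RZ i)) * T i : ℕ) : ℝ) * r ^ d i)
        atTop (𝓝 0)) :
    IsThresholdLowerBound (xPhenomFailureFamily C T D) (thresholdValue ((w + 1 : ℕ) : ℝ)) :=
  z_phenom_isThresholdLowerBound_of_rowWeight (fun i => (C i).swap) T D hD hrow d hd1 hd hgrowth

/-! ### Non-vacuity of the decoder classes -/

/-- The canonical minimum-weight decoders of the `X`-syndromes qualify for the `Z`-sector theorems (the decoder
class quantified over is never empty). [cite: DumerKovalevPryadko2015, p. 3 (exhaustive minimum-weight decoding)] -/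
theorem isMinWeight_minWeight_zSyndrome_family [∀ i, Fintype (Q i)]
    (C : ∀ i, CSSCode (RX i) (RZ i) (Q i)) (i : ℕ) :
    (Decoder.minWeight (C i).zSyndrome hammingNorm).IsMinWeight (C i).zSyndrome
      ((C i).kerX : Set (Q i → ZMod 2)) hammingNorm :=
  (C i).isMinWeight_minWeight_zSyndrome

/-- The canonical minimum-weight decoders of the `Z`-syndromes qualify for the `X`-sector theorems.
[cite: DumerKovalevPryadko2015, p. 3 (exhaustive minimum-weight decoding)] -/
theorem isMinWeight_minWeight_xSyndrome_family [∀ i, Fintype (Q i)]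
    (C : ∀ i, CSSCode (RX i) (RZ i) (Q i)) (i : ℕ) :
    (Decoder.minWeight (C i).xSyndrome hammingNorm).IsMinWeight (C i).xSyndrome
      ((C i).kerZ : Set (Q i → ZMod 2)) hammingNorm :=
  (C i).isMinWeight_minWeight_xSyndrome

/-- The canonical minimum-weight SPACE-TIME decoders qualify for the `Z`-sector phenomenological theorem.
[cite: DennisEtAl2002, §5.1 eq. (E_min)] -/
theorem isMinWeight_stMinWeight_z_family [∀ i, Fintype (Q i)] [∀ i, Fintype (RX i)] [∀ i, DecidableEq (RX i)]
    (C : ∀ i, CSSCode (RX i) (RZ i) (Q i)) (T : ℕ → ℕ) (i : ℕ) :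
    (Decoder.minWeight (CSSPhenom.stSyn (C i).HX (T i)) hammingNorm).IsMinWeight
      (CSSPhenom.stSyn (C i).HX (T i)) (CSSPhenom.stCycles (C i).HX (T i)) hammingNorm :=
  CSSPhenom.isMinWeight_minWeight _ _

end Summit.Ventures.QEC.Thresholds
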